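import Literature.Combinatorics.Optimization.PatternMatrixPsdRank
import Literature.Barriers.PneNP.TSPExtensionComplexityRothvossAssembly
import HarnessLib

/-!
# Barrier: the matching slack matrix has an entrywise approximation of psd rank `2^{Õ(√n)}`
# (Kaniewski–Lee–de Wolf 2015, Theorem 19)

J. Kaniewski, T. Lee, R. de Wolf, *Query complexity in expectation*, ICALP 2015, LNCS 9134,
761–772 (arXiv:1411.7280; held `paper:arxiv-1411.7280`, locators = pages of that rendering)
[KaniewskiLeeDewolf2015], §7.3 "Application: approximating the slack matrix of the matching
polytope", **Theorem 19** (p. 12), verbatim: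

"For every `ε > 0` there exists a matrix `S̃` of psd rank `2^{O(n^{1/2+ε} (log n)²)}` such that
(1) `S_{UM} − 2^{−(n/2)^{2ε}} ≤ S̃_{UM} ≤ S_{UM}` for the `UM`-entries where `|δ(U) ∩ M| > (n/2)^{2ε}`;
(2) `S̃_{xy} = S_{xy}` for all other entries."

Here (p. 12) "the corresponding slack matrix `S` has columns indexed by all perfect matchings `M`
in `K_n` and rows indexed by odd-sized sets `U` with entries `S_{UM} = |δ(U) ∩ M| − 1`. There are
`O(n²)` additional rows for the degree and nonnegativity constraints."  The authors' gloss: "This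
shows a big difference to the case of nonnegative rank: Braun and Pokutta show that any `S̃` that
is `O(1/n)`-close to `S` needs nonnegative rank `2^{Ω(n)}`" [BraunPokutta2014, Thm. 3.1].  The
proof (Thm. 18: a `T`-query quantum algorithm computing `f_y` in expectation gives
`rk_psd ≤ (2n)^{2T}`; Appendix: `|z| − 1` on `m = n/2` bits is approximable in expectation to error
`2^{−m^{2ε}}` with `O(m^{1/2+ε} log m)` queries) is not reproduced in this file: NAMED FACT here,
DISCHARGED (2026-08-28) in `MatchingSlackPsdApproximationProof.lean` —
`KaniewskiLeeDewolf2015_thm19_holds` (de-quantised: explicit Grover/Chebyshev polynomials and cube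
sum-of-squares certificates, `Literature/Combinatorics/Optimization/GroverSosCertificates.lean`, give
the psd factorisations; `C = 10⁴`, `n₀ = 4`), so the ceiling below holds unconditionally
(`approxRobustPsdBound_ceiling` there).  The LP side of the authors' gloss is proved there as well for
the admissible class (1)–(2) itself: `KLWApprox.klwPerturbation_nonnegRank_all` /
`KLWApprox.approxRobustNonnegBound_floor` (every `(ε, n)`-admissible `S̃` has NONNEGATIVE rank
`≥ 2^{cn}` for an absolute `c > 0` and all large even `n`, by Rothvoß's Lemmas 5–6 on the tree's slot
model plus padding) and the headline `KLWApprox.KaniewskiLeeDewolf2015_contrast`; Rothvoß's Theorem 1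
for `P_PM(n)` at all large even `n` is `Rothvoss2017_thm1` (`PerfectMatchingExtensionComplexity.lean`).
Braun–Pokutta's theorem for uniformly `O(1/n)`-close `S̃` is a different statement, not formalised.

* the ODD-CUT SLACK MATRIX `pmOddCutSlack n U M = |δ(U) ∩ M| − 1` on the Rothvoß files' own index
  types `OddSet n` (rows: all odd `U ⊆ Fin n`) and `PMatch n` (columns: perfect matchings of `K_n`
  as edge sets `IsPMOn univ M`), with `|δ(U) ∩ M| = cc U M`
  (`TSPExtensionComplexityRothvossAssembly.lean`) — no new vocabulary.
* `KaniewskiLeeDewolf2015_thm19` — the theorem, RESTRICTED to the odd-set block of `S` (a psd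
  factorisation of the printed `S̃` restricts to any set of rows, so the printed statement implies
  this one; conversely the omitted rows are exact `0/1` rows costing psd rank `O(n²)`), with the
  `O(·)` unfolded as "`∃ C, ∃ n₀, ∀ even n ≥ n₀`" and psd rank `≤ r` as
  `Literature.Combinatorics.Optimization.HasPsdFactorization S̃ r` (LRS Def. 1.7, as typed in
  `PatternMatrixPsdRank.lean`).
* `IsApproxRobustPsdBound` (the TECHNIQUE CLASS, a Lean definition) and the proved corollary
  `KaniewskiLeeDewolf2015_thm19.ceiling`: a psd-rank lower bound `R(n)` for the matching slack
  matrix that is certified by an argument insensitive to the perturbations (1)–(2) is at most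
  `2^{C_ε n^{1/2+ε} (log n)²}`.

technique_class: approximation-robust psd-rank / semidefinite-extension-complexity lower bounds —
  arguments whose conclusion `rk_psd ≥ R` survives replacing the slack matrix `S` by any `S̃` with
  `S̃ = S` on the entries with `|δ(U) ∩ M| ≤ (n/2)^{2ε}` and `S − 2^{−(n/2)^{2ε}} ≤ S̃ ≤ S` elsewhere
  (`IsApproxRobustPsdBound` below); this includes bounds read off smooth/analytic functionals of the
  large-crossing entries and, by the authors' remark, is the psd analogue of the approximation-robust
  nonnegative-rank methods (common information, hyperplane separation with bounded test matrices)
  that DO give `2^{Ω(n)}` in the LP world [BraunPokutta2014, Thm. 3.1] (for the class (1)–(2) itself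
  this is the tree's theorem `KLWApprox.approxRobustNonnegBound_floor`). [cite: KaniewskiLeeDewolf2015, §7.3 (p. 12)]
blocks: a `2^{Ω(n^{1/2+ε'})}` (`ε' > ε`), in particular a `2^{Ω(n)}` (Rothvoß-strength), lower bound
  on the psd rank of Edmonds' slack matrix / the semidefinite extension complexity of the perfect
  matching polytope by any approximation-robust method; it does NOT block bounds of the form
  `2^{n^{δ}}`, `δ ≤ 1/2`, nor methods that use the EXACT values of the large-crossing entries.
  [cite: KaniewskiLeeDewolf2015, Thm. 19 (p. 12)]
because: the row functions `M ↦ |δ(U) ∩ M| − 1 = g(x_U)` with `g(z) = |z| − 1` admit quantum query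
  algorithms computing them in expectation up to error `2^{−m^{2ε}}` with `O(m^{1/2+ε} log m)`
  queries (Grover-type counting, Appendix Thm.), and `T` expected-value queries give a two-way
  quantum protocol / psd factorisation of size `(2n)^{2T}` (Thms. 17–18).
  [cite: KaniewskiLeeDewolf2015, Thms. 17–19 (pp. 11–12)]
evasions_known: none published for the matching polytope.  Candidate non-robust routes named in
  print: exactness-based algebraic certificates — Gribling–de Laat–Laurent's noncommutative
  polynomial-optimisation hierarchy `ξ^{psd}_t` (their concluding question asks for a sum-of-squares
  re-proof of Rothvoß's bound and its noncommutative extension) [cite: GriblingDelaatLaurent2019, §1 (p. 3), concluding remarks (p. 26)];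
  symmetry-restricted models, where exact SOS-degree arguments apply and give `2^{Ω(n)}`
  (Braun–Brown-Cohen–Huq–Pokutta–Raghavendra–Roy–Weitz–Zink, symmetric SDPs) [cite: BraunEtAl2016, Thm. 4.10].
scope_caveats: printed for the COMPLETE graph `K_n`, `n` even, asymptotically in `n`, for each fixed
  `ε > 0` (constant in the `O` depends on `ε`); the approximation is ONE-SIDED from below and only
  on entries with `|δ(U) ∩ M| > (n/2)^{2ε}` — entries with small crossing number (in particular all
  entries with `S_{UM} = 0`, the support structure Rothvoß's rectangle argument uses) are EXACT, so
  the theorem says nothing against arguments driven by the zero/small-slack pattern plus exactness;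
  it is an upper bound on an APPROXIMATE psd rank, not on `rk_psd(S)` itself, which remains open in
  both directions. [cite: KaniewskiLeeDewolf2015, Thm. 19 (p. 12)]
status: established (ICALP 2015 proceedings; no dissent known; Theorem 19 re-proved in the tree,
  `KaniewskiLeeDewolf2015_thm19_holds`).
-/

noncomputable section

open Finset

namespace Literature.Barriers.PneNP

open Literature.Combinatorics.Optimization (HasPsdFactorization)

variable {n : ℕ}

/-- **The odd-cut slack matrix** of the perfect matching polytope of `K_n`:
`S_{UM} = |δ(U) ∩ M| − 1` (rows: odd `U`, `OddSet n`; columns: perfect matchings `M`, `PMatch n`;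
`|δ(U) ∩ M| = cc U M`). [cite: KaniewskiLeeDewolf2015, §7.3 (p. 12)] -/
def pmOddCutSlack (n : ℕ) (U : OddSet n) (M : PMatch n) : ℝ :=
  (cc U M : ℝ) - 1

/-- Unfolding of the slack entry. [cite: KaniewskiLeeDewolf2015, §7.3 (p. 12)] -/
theorem pmOddCutSlack_apply (U : OddSet n) (M : PMatch n) :
    pmOddCutSlack n U M = (cc U M : ℝ) - 1 := rfl

/-- `S̃` is an **`(ε, n)`-admissible perturbation** of the odd-cut slack matrix `S`: it agrees with
`S` on the entries with `|δ(U) ∩ M| ≤ (n/2)^{2ε}` and satisfies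
`S_{UM} − 2^{−(n/2)^{2ε}} ≤ S̃_{UM} ≤ S_{UM}` on the others — conditions (1)–(2) of Theorem 19.
[cite: KaniewskiLeeDewolf2015, Thm. 19 (p. 12)] -/
def IsKLWPerturbation (n : ℕ) (ε : ℝ) (St : OddSet n → PMatch n → ℝ) : Prop :=
  ∀ (U : OddSet n) (M : PMatch n),
    ((cc U M : ℝ) ≤ ((n : ℝ) / 2) ^ (2 * ε) → St U M = pmOddCutSlack n U M) ∧
    (((n : ℝ) / 2) ^ (2 * ε) < cc U M →
      pmOddCutSlack n U M - (2 : ℝ) ^ (-(((n : ℝ) / 2) ^ (2 * ε))) ≤ St U M ∧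
        St U M ≤ pmOddCutSlack n U M)

/-- The slack matrix itself is an admissible perturbation (so the class is non-empty and the
theorem below is about a genuine relaxation of `rk_psd(S)`). [cite: KaniewskiLeeDewolf2015, Thm. 19 (p. 12)] -/
theorem isKLWPerturbation_self (n : ℕ) {ε : ℝ} : IsKLWPerturbation n ε (pmOddCutSlack n) := by
  intro U M
  refine ⟨fun _ => rfl, fun _ => ⟨?_, le_rfl⟩⟩
  have : (0 : ℝ) ≤ (2 : ℝ) ^ (-(((n : ℝ) / 2) ^ (2 * ε))) := by positivity
  linarith

/-- **Kaniewski–Lee–de Wolf 2015, Theorem 19** (odd-set block). For every `ε > 0` there are a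
constant `C` and a threshold `n₀` such that for every even `n ≥ n₀` there is a matrix `S̃` on
(odd sets) × (perfect matchings of `K_n`) which is an `(ε, n)`-admissible perturbation of the
odd-cut slack matrix `S_{UM} = |δ(U) ∩ M| − 1` (equal to `S` where `|δ(U) ∩ M| ≤ (n/2)^{2ε}`,
within `2^{−(n/2)^{2ε}}` below `S` elsewhere) and has a positive-semidefinite factorisation of
size `r ≤ 2^{C · n^{1/2+ε} · (log n)²}`, i.e. "psd rank `2^{O(n^{1/2+ε}(log n)²)}`".  (Printed for
the full Edmonds slack matrix including the `O(n²)` degree/nonnegativity rows, on which `S̃ = S`;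
restricting a factorisation to the odd-set rows gives this form.)
[cite: KaniewskiLeeDewolf2015, Thm. 19 (p. 12)] -/
def KaniewskiLeeDewolf2015_thm19 : Prop :=
  ∀ ε : ℝ, 0 < ε → ∃ C : ℝ, ∃ n₀ : ℕ, ∀ n : ℕ, n₀ ≤ n → Even n →
    ∃ (r : ℕ) (St : OddSet n → PMatch n → ℝ),
      (r : ℝ) ≤ (2 : ℝ) ^ (C * (n : ℝ) ^ (1 / 2 + ε) * Real.log n ^ 2) ∧
      HasPsdFactorization St r ∧ IsKLWPerturbation n ε St

/-- **The technique class this barrier addresses.** `R` is an *approximation-robust psd-rank lower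
bound at `(ε, n)`*: EVERY `(ε, n)`-admissible perturbation `S̃` of the odd-cut slack matrix of
`K_n` has psd rank `≥ R`, i.e. no psd factorisation of size `< R`.  (A lower-bound argument that
only reads the exact small-crossing entries and is monotone/continuous to precision `2^{−(n/2)^{2ε}}`
in the large-crossing ones certifies such an `R`.) [cite: KaniewskiLeeDewolf2015, §7.3 (p. 12)] -/
def IsApproxRobustPsdBound (n : ℕ) (ε : ℝ) (R : ℕ) : Prop :=
  ∀ St : OddSet n → PMatch n → ℝ, IsKLWPerturbation n ε St → ∀ r : ℕ, r < R → ¬HasPsdFactorization St r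

/-- **Ceiling (corollary of Theorem 19).** Assuming the fact: for every `ε > 0` there are `C, n₀`
such that every approximation-robust psd-rank lower bound `R` for the matching slack matrix of
`K_n`, `n ≥ n₀` even, satisfies `R ≤ 2^{C n^{1/2+ε} (log n)²}` — approximation-robust methods
cannot prove more than `2^{Õ(√n)}` for the perfect matching polytope.
[cite: KaniewskiLeeDewolf2015, Thm. 19 (p. 12)] -/
theorem KaniewskiLeeDewolf2015_thm19.ceiling (h : KaniewskiLeeDewolf2015_thm19) {ε : ℝ}
    (hε : 0 < ε) : ∃ C : ℝ, ∃ n₀ : ℕ, ∀ n : ℕ, n₀ ≤ n → Even n → ∀ R : ℕ,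
      IsApproxRobustPsdBound n ε R → (R : ℝ) ≤ (2 : ℝ) ^ (C * (n : ℝ) ^ (1 / 2 + ε) * Real.log n ^ 2) := by
  obtain ⟨C, n₀, H⟩ := h ε hε
  refine ⟨C, n₀, fun n hn he R hR => ?_⟩
  obtain ⟨r, St, hr, hfac, hpert⟩ := H n hn he
  have hRr : R ≤ r := by
    by_contra hlt
    exact hR St hpert r (lt_of_not_ge hlt) hfac
  exact le_trans (by exact_mod_cast hRr) hr

end Literature.Barriers.PneNP
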